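import Summits.ResolutionOfSingularities.ResolutionOfSingularities.Theorems.EquisingularLiftEquisingularLiftNatResidueHypDefsE6
import HarnessLib

/-!
# [OURS · L1 W4.5(b) · EL♮ / EL♮(3)] RESIDUE HYPOTHESIS DEFS E7 — WIDTH TABLE D13 «(P-ram-Γ) / E-ROUND»: the tail rule `TowerPRamGamma`, the ΣPG-doors
# `ReachDirectPlanarNoseSigmaPG₂` / `ReachDirectCINoseSigmaPG₂` and the blob `NoseHypHostedNestEquinodalDirectCISigmaPGBTriplePrime₂`

Typed by res-type-027 g23 on the desk's RULING R76 (2026-08-29T09:15Z, D13 DEALT in principle on the customer S♭ «(3,7)-crease nose» = V(g♭² + w⁴B₂) ⊂ ℙ³/𝔽̄₇,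
lead-1 `SFLAT-CERTIFICATE.md` 3562eb86dc16c7e7, crit-2 BY TOOL sflat ✓, rider R-SF-1 ¬(i); filing on crit-3's countersign).  Letters: idea-2 g30 08:24/08:30/08:37Z,
idea-3 g16 08:37Z, = stub-2 g20's E-ROUND licence binder 2c9419fb1d0b4145 read downstairs (rule text of record rev2 f8a5defe854d7314, idea-2 PASS ×2
08:40:24Z).  WHAT.  (1) `TowerPRamGamma` — the combined «ramified point step + immediate plane round» TAIL rule (see its docstring), with the R76 (ii) E-menu
disjunct «`∨ E'' = ∅`».  (2) `ReachDirectPlanarNoseSigmaPG₂` / `ReachDirectCINoseSigmaPG₂` = ✓ `ReachDirectPlanarNoseSigma₂` / ✓ `ReachDirectCINoseSigma₂` (…DefsE6)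
VERBATIM with ONE more inserted tail hypothesis `TowerPRamGamma ℙ F₃ υ' Z hZ R →` after `TowerSecRoundSigma … R →`.  (3) blob
`NoseHypHostedNestEquinodalDirectCISigmaPGBTriplePrime₂` = ✓ the Σ-blob (…DefsE6) VERBATIM with the two Σ-doors replaced by their ΣPG-variants (rule door
«(ν4 ∨ ν3ᵈΣΓ) ∨ ν3ᶜⁱΣΓ»).  (4) pure logic: Σ-door ⇒ ΣPG-door (`…SigmaPG₂_of_sigma₂` ×2), Σ-blob ⇒ ΣPG-blob (`…SigmaPG…₂_of_directCISigma₂`), and the contrapositives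
the REPLACE cut «¬(Σ-blob) ↦ ¬(ΣPG-blob)» consumes (`not_noseHypHostedNestEquinodalDirectCISigmaBTriplePrime₂_of_not_directCISigmaPG₂` and the chain down to
`NoseHypPointsFirstBTriplePrime`, via ✓ DefsE6's lemmas).  The supplier SLOT `HPRamGammaSupplier` is ✓p710786 (…NatPrefixSupplierDefs, 9th slot), inhabited at
`n = 3` by stub-2's `TCPlus.pRamGamma_step` / cap `TCPlus.hpramGamma_supplier`.  OURS; NOT statements of any manuscript ([Hironaka2017] a candidate only);
AI-written, weaker than expert review; no `sorry`, no instance, no notation; `--kind definition --supports stmt-ResolutionOfSingularities-20148 --as helper`.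
-/

set_option linter.dupNamespace false
noncomputable section
open CategoryTheory CategoryTheory.Limits AlgebraicGeometry TopologicalSpace Topology IsLocalRing
open Literature.AlgebraicGeometry.Resolution
open AlgebraicGeometry.Scheme.IdealSheafData
open Summit.ResolutionOfSingularities.ResolutionOfSingularities.Theses.EquisingularLift.Split
open Summit.ResolutionOfSingularities.ResolutionOfSingularities.Cruxes.EquisingularLift.StrataSplit
namespace Summit.ResolutionOfSingularities.ResolutionOfSingularities.Cruxes.EquisingularLiftNat.Sections

/-- **`TowerPRamGamma F₉ F₁₀ υ' Z₉ hZ₉ R`** — the combined «(P-ram-Γ) / E-ROUND» tail rule = RAMIFIED POINT STEP followed AT ONCE by the POINT-TYPE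
PLANE ROUND in the fresh exceptional plane (WIDTH TABLE D13, desk R74 (iii) / R74b (c)(d); customer lead-1 `SFLAT-CERTIFICATE.md` 3562eb86dc16c7e7 §5–§6,
engine lemma `E-ROUNDS.md` 6e4258499227b511 (3.1); letters idea-2 g30 08:24/08:30/08:37Z, idea-3 g16 08:37Z, = stub-2 g20's E-ROUND licence binder
2c9419fb1d0b4145 read DOWNSTAIRS with `𝓙 := J.comap υ₂`).  From a reached tail position `R G γ T E Es Ns K`: the RAM letters of ✓ `TowerPtRamB₄` (:69–:76
VERBATIM: a closed point `y` of `T̃` where neither `T̃` nor the ambient is regular, an ideal `J` supported at `pt := curvePt G T y` generated in the stalk by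
three cotangent-independent elements of `𝔪`), the blow-up `υ₂` of `J`; then in `G'` the customer's CHOSEN blow-up ideal `𝓘 ⊇ J·𝒪_{G'}` (so its support lies
in the FRESH plane `υ₂⁻¹{pt}`; for `e ≥ 2` it is NOT determined by its support, idea-2 (β)) with support inside `St T` and non-empty, (Γ1) `V(𝓘)` one-dimensional
at its closed points, (PΓ) at every closed point of the support `𝓘` is `J·𝒪_{G'}` plus ONE element outside `J·𝒪_{G'} + 𝔪²` («curvilinear-regular»; the (L2)
shape with host ideal `J·𝒪_{G'}`), (UΓ) the two-affine Čech clause for `V(𝓘) ↪ V(J·𝒪_{G'})` (`DirStepUnobs`'s bytes in subscheme currency); the blow-up `υ₃`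
of `𝓘`; HOSTLESS output two stages down: `K'' = ∅`, the running surface = ✓ B₄'s E-menu transported twice OR DROPPED (`E'' = ∅`, idea-2's (E3)-point widening for S_pp, desk R76 (ii)), `Es''` = away-transports, `Ns''` may list
away-transports, the strict transform of the fresh plane and the new exceptional divisor `υ₃⁻¹ supp 𝓘`.  No (T2)/embedding-dimension letter (idea-2/idea-3
(q2): consumed by nobody in Lean; the customer keeps «`I_C·𝒪_T = I_Γ·𝒪_T`» in the certificate).  The parameters `F₉ F₁₀ υ' Z₉ hZ₉` are kept only for
uniformity with the other tail rules.  Upstairs supplier (not here; stub-2 g20): `ERound.eRoundLift` on `E_{L′} ≅ ℙ²_{O″}` after ✓ `fatPointStep_model`.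
Text of record rev2 f8a5defe854d7314 + the R76 (ii) one-line E-menu widening. [OURS · named hypothesis fragment, no mathematical content of its own] -/
def TowerPRamGamma (F₉ F₁₀ : Scheme.{0}) (_υ' : F₁₀ ⟶ F₉) (Z₉ : Set F₉) (_hZ₉ : IsClosed Z₉)
    (R : ∀ G : Scheme.{0}, (G ⟶ F₁₀) → Set G → Set G → List (Set G) → List (Set G) → Set G → Prop) : Prop :=
  ∀ (G G' G'' : Scheme.{0}) (γ : G ⟶ F₁₀) (T E : Set G) (Es Ns : List (Set G)) (K : Set G) (y : redSub G (closure T) isClosed_closure)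
      (J : G.IdealSheafData) (υ₂ : G' ⟶ G) (𝓘 : G'.IdealSheafData) (υ₃ : G'' ⟶ G')
      (K'' : Set G'') (E'' : Set G'') (Es'' Ns'' : List (Set G'')),
    R G γ T E Es Ns K →
    -- the RAM letters (✓ `TowerPtRamB₄` :69–:76 verbatim)
    ¬ IsRegularLocalRing ((redSub G (closure T) isClosed_closure).presheaf.stalk y) →
    ¬ IsRegularLocalRing (G.presheaf.stalk (curvePt G T y)) →
    (J.support : Set G) = {curvePt G T y} →
    (∃ (ℓ : Fin 3 → G.presheaf.stalk (curvePt G T y)) (hℓ : ∀ i, ℓ i ∈ IsLocalRing.maximalIdeal (G.presheaf.stalk (curvePt G T y))),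
      stalkIdeal J (curvePt G T y) = Ideal.span (Set.range ℓ) ∧
      LinearIndependent (IsLocalRing.ResidueField (G.presheaf.stalk (curvePt G T y)))
        (fun i => (IsLocalRing.maximalIdeal (G.presheaf.stalk (curvePt G T y))).toCotangent ⟨ℓ i, hℓ i⟩)) →
    IsBlowup υ₂ J →
    -- the PLANE ROUND: the customer's CHOSEN blow-up ideal `𝓘 ⊇ J·𝒪_{G'}` (centre support inside the fresh plane, automatically, and inside `St T`),
    -- letters = stub-2 g20's E-ROUND licence binder 2c9419fb1d0b4145 VERBATIM with `𝓙 := J.comap υ₂`: (Γ1) one-dimensional, (PΓ) curvilinear-regular, (UΓ) Čech-unobstructed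
    J.comap υ₂ ≤ 𝓘 → (𝓘.support : Set G') ⊆ closure (υ₂ ⁻¹' (T \ {curvePt G T y})) → (𝓘.support : Set G').Nonempty →
    (∀ z : ↥𝓘.subscheme, IsClosed ({z} : Set ↥𝓘.subscheme) → ringKrullDim (𝓘.subscheme.presheaf.stalk z) = ((1 : ℕ) : WithBot ℕ∞)) →
    (∀ x ∈ (𝓘.support : Set G'), IsClosed ({x} : Set G') → ∃ f : G'.presheaf.stalk x,
      stalkIdeal 𝓘 x = stalkIdeal (J.comap υ₂) x ⊔ Ideal.span {f} ∧
        f ∉ stalkIdeal (J.comap υ₂) x ⊔ (maximalIdeal (G'.presheaf.stalk x)) ^ 2) →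
    (∀ (i : 𝓘.subscheme ⟶ (J.comap υ₂).subscheme), i ≫ (J.comap υ₂).subschemeι = 𝓘.subschemeι →
      ∃ V : Fin 2 → (𝓘.subscheme).Opens, (∀ l, IsAffineOpen (V l)) ∧ IsAffineOpen (V 0 ⊓ V 1) ∧ ⨆ l, V l = ⊤ ∧
        Subsingleton (Literature.AlgebraicGeometry.Morphisms.CechMH1 𝓘.subscheme.toSpecΓ (Literature.AlgebraicGeometry.HodgeTheory.normalSheaf i) V)) →
    IsBlowup υ₃ 𝓘 →
    -- HOSTLESS output two stages down (✓ B₄'s menus composed with the plane round at `supp 𝓘 ⊆ υ₂⁻¹ pt`)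
    K'' = ∅ →
    ((curvePt G T y ∉ E ∧ E'' = closure (υ₃ ⁻¹' (closure (υ₂ ⁻¹' (E \ {curvePt G T y})) \ (𝓘.support : Set G')))) ∨
      (∃ F ∈ E :: Es, curvePt G T y ∉ F ∧ E'' = closure (υ₃ ⁻¹' (closure (υ₂ ⁻¹' (F \ {curvePt G T y})) \ (𝓘.support : Set G')))) ∨
      E'' = ∅) →
    (∀ F'' ∈ Es'', ∃ F ∈ E :: Es, curvePt G T y ∉ F ∧ F'' = closure (υ₃ ⁻¹' (closure (υ₂ ⁻¹' (F \ {curvePt G T y})) \ (𝓘.support : Set G')))) →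
    (∀ F'' ∈ Ns'', (∃ F ∈ (E :: Es) ++ Ns, F'' = closure (υ₃ ⁻¹' (closure (υ₂ ⁻¹' (F \ {curvePt G T y})) \ (𝓘.support : Set G')))) ∨
      F'' = closure (υ₃ ⁻¹' (υ₂ ⁻¹' {curvePt G T y} \ (𝓘.support : Set G'))) ∨ F'' = υ₃ ⁻¹' (𝓘.support : Set G')) →
    R G'' (υ₃ ≫ υ₂ ≫ γ) (closure (υ₃ ⁻¹' (closure (υ₂ ⁻¹' (T \ {curvePt G T y})) \ (𝓘.support : Set G')))) E'' Es'' Ns'' K''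

/-- **`ReachDirectPlanarNoseSigmaPG₂`** — ✓ `ReachDirectPlanarNoseSigma₂` (…DefsE6) VERBATIM with ONE more inserted tail hypothesis `TowerPRamGamma ℙ F₃ υ' Z hZ R →`
after `TowerSecRoundSigma … R →` (the tail motive is ALSO asked to be closed under the (P-ram-Γ) E-round; D13). [OURS · named hypothesis fragment, no mathematical content of its own] -/
def ReachDirectPlanarNoseSigmaPG₂ (k : Type) [Field k] (n : ℕ) (ℓ : MvPolynomial (Fin (n + 1)) k)
    (T₁ : Set (Literature.AlgebraicGeometry.Motives.projectiveSpace n k).left) (F₉ : Scheme.{0}) (β : F₉ ⟶ (Literature.AlgebraicGeometry.Motives.projectiveSpace n k).left) (T₉ E₉ : Set F₉) : Prop :=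
  letI := MvPolynomial.gradedAlgebra (σ := Fin (n + 1)) (R := k)
  E₉ = ∅ ∧
  ∃ (Z : Set (Literature.AlgebraicGeometry.Motives.projectiveSpace n k).left) (hZ : IsClosed Z),
    Z ⊆ T₁ ∧ ¬ (T₁ ⊆ Z) ∧ Z.Infinite ∧
    Z ⊆ {y : (Literature.AlgebraicGeometry.Motives.projectiveSpace n k).left | ℓ ∈ (y : ProjectiveSpectrum (MvPolynomial.homogeneousSubmodule (Fin (n + 1)) k)).asHomogeneousIdeal} ∧
    IsPreirreducible Z ∧
    -- curve clause
    (∀ z : ↥(redSub (Literature.AlgebraicGeometry.Motives.projectiveSpace n k).left Z hZ), IsClosed ({z} : Set ↥(redSub (Literature.AlgebraicGeometry.Motives.projectiveSpace n k).left Z hZ)) →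
      ringKrullDim ((redSub (Literature.AlgebraicGeometry.Motives.projectiveSpace n k).left Z hZ).presheaf.stalk z) = ((1 : ℕ) : WithBot ℕ∞)) ∧
    -- ambient regular along `Z̃`
    (∀ (i : redSub (Literature.AlgebraicGeometry.Motives.projectiveSpace n k).left Z hZ ⟶ redSub (Literature.AlgebraicGeometry.Motives.projectiveSpace n k).left Set.univ isClosed_univ), i ≫ redSubι (Literature.AlgebraicGeometry.Motives.projectiveSpace n k).left Set.univ isClosed_univ = redSubι (Literature.AlgebraicGeometry.Motives.projectiveSpace n k).left Z hZ →
      ∀ z : ↥(redSub (Literature.AlgebraicGeometry.Motives.projectiveSpace n k).left Z hZ), IsRegularLocalRing ((redSub (Literature.AlgebraicGeometry.Motives.projectiveSpace n k).left Set.univ isClosed_univ).presheaf.stalk (i.base z))) ∧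
    -- host regular along `Z̃`
    (∀ (i : redSub (Literature.AlgebraicGeometry.Motives.projectiveSpace n k).left Z hZ ⟶ redSub (Literature.AlgebraicGeometry.Motives.projectiveSpace n k).left (closure {y : (Literature.AlgebraicGeometry.Motives.projectiveSpace n k).left | ℓ ∈ (y : ProjectiveSpectrum (MvPolynomial.homogeneousSubmodule (Fin (n + 1)) k)).asHomogeneousIdeal}) isClosed_closure),
      i ≫ redSubι (Literature.AlgebraicGeometry.Motives.projectiveSpace n k).left (closure {y : (Literature.AlgebraicGeometry.Motives.projectiveSpace n k).left | ℓ ∈ (y : ProjectiveSpectrum (MvPolynomial.homogeneousSubmodule (Fin (n + 1)) k)).asHomogeneousIdeal}) isClosed_closure = redSubι (Literature.AlgebraicGeometry.Motives.projectiveSpace n k).left Z hZ →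
      ∀ z : ↥(redSub (Literature.AlgebraicGeometry.Motives.projectiveSpace n k).left Z hZ), IsRegularLocalRing ((redSub (Literature.AlgebraicGeometry.Motives.projectiveSpace n k).left (closure {y : (Literature.AlgebraicGeometry.Motives.projectiveSpace n k).left | ℓ ∈ (y : ProjectiveSpectrum (MvPolynomial.homogeneousSubmodule (Fin (n + 1)) k)).asHomogeneousIdeal}) isClosed_closure).presheaf.stalk (i.base z))) ∧
    -- host two-dimensional along `Z` (n = 3 in effect)
    (∀ e : ↥(redSub (Literature.AlgebraicGeometry.Motives.projectiveSpace n k).left (closure {y : (Literature.AlgebraicGeometry.Motives.projectiveSpace n k).left | ℓ ∈ (y : ProjectiveSpectrum (MvPolynomial.homogeneousSubmodule (Fin (n + 1)) k)).asHomogeneousIdeal}) isClosed_closure),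
      IsClosed ({e} : Set ↥(redSub (Literature.AlgebraicGeometry.Motives.projectiveSpace n k).left (closure {y : (Literature.AlgebraicGeometry.Motives.projectiveSpace n k).left | ℓ ∈ (y : ProjectiveSpectrum (MvPolynomial.homogeneousSubmodule (Fin (n + 1)) k)).asHomogeneousIdeal}) isClosed_closure)) →
      (redSubι (Literature.AlgebraicGeometry.Motives.projectiveSpace n k).left (closure {y : (Literature.AlgebraicGeometry.Motives.projectiveSpace n k).left | ℓ ∈ (y : ProjectiveSpectrum (MvPolynomial.homogeneousSubmodule (Fin (n + 1)) k)).asHomogeneousIdeal}) isClosed_closure e : (Literature.AlgebraicGeometry.Motives.projectiveSpace n k).left) ∈ Z →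
      ringKrullDim ((redSub (Literature.AlgebraicGeometry.Motives.projectiveSpace n k).left (closure {y : (Literature.AlgebraicGeometry.Motives.projectiveSpace n k).left | ℓ ∈ (y : ProjectiveSpectrum (MvPolynomial.homogeneousSubmodule (Fin (n + 1)) k)).asHomogeneousIdeal}) isClosed_closure).presheaf.stalk e) = ((2 : ℕ) : WithBot ℕ∞)) ∧
    -- (N1) finitely many non-regular points of the reduced nose `Z̃` (requested binder; = stub-2's SIG binder verbatim)
    Set.Finite {z : ↥(redSub (Literature.AlgebraicGeometry.Motives.projectiveSpace n k).left Z hZ) |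
      ¬ IsRegularLocalRing ((redSub (Literature.AlgebraicGeometry.Motives.projectiveSpace n k).left Z hZ).presheaf.stalk z)} ∧
    -- the EQUATION block (= `EqCertAt₀`'s clauses 1–4: hyperplane coordinates `B` and ONE squarefree form `g` cutting out `Z` on `V₊(ℓ)`)
    (∃ (e : ℕ) (g : MvPolynomial (Fin (n + 1)) k) (B : Fin (n + 1) → Fin n → k) (r : Fin n → Fin (n + 1)),
      g.IsHomogeneous e ∧ Squarefree (restrictToHyperplane B g) ∧
      Z = {y : (Literature.AlgebraicGeometry.Motives.projectiveSpace n k).left | ℓ ∈ (y : ProjectiveSpectrum (MvPolynomial.homogeneousSubmodule (Fin (n + 1)) k)).asHomogeneousIdeal ∧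
             g ∈ (y : ProjectiveSpectrum (MvPolynomial.homogeneousSubmodule (Fin (n + 1)) k)).asHomogeneousIdeal} ∧
      restrictToHyperplane B ℓ = 0 ∧ Function.Injective r ∧ (Matrix.of fun j j' : Fin n => B (r j) j').det ≠ 0) ∧
    -- the DIRECT nose round at `Z` itself (no inner motive, no reached-stage clauses), then a B‴ tail
    ∃ (F₃ : Scheme.{0}) (υ' : F₃ ⟶ (Literature.AlgebraicGeometry.Motives.projectiveSpace n k).left),
      IsBlowup υ' (vanishingIdeal (⟨Z, hZ⟩ : Closeds (Literature.AlgebraicGeometry.Motives.projectiveSpace n k).left)) ∧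
      ∃ (γ' : F₉ ⟶ F₃) (E' : Set F₉) (Es' Ns' : List (Set F₉)) (K' : Set F₉),
        (∀ R : (∀ G : Scheme.{0}, (G ⟶ F₃) → Set G → Set G → List (Set G) → List (Set G) → Set G → Prop),
          R F₃ (𝟙 F₃) (closure (υ' ⁻¹' (T₁ \ Z))) (υ' ⁻¹' Z) [] [] ∅ →
          TowerPtRegB₄ F₃ R → TowerPtRamB₄ F₃ R → TowerRoundBTriplePrime (Literature.AlgebraicGeometry.Motives.projectiveSpace n k).left F₃ υ' Z hZ R →
          TowerSecRoundSigma (Literature.AlgebraicGeometry.Motives.projectiveSpace n k).left F₃ υ' Z hZ R →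
          TowerPRamGamma (Literature.AlgebraicGeometry.Motives.projectiveSpace n k).left F₃ υ' Z hZ R →
          R F₉ γ' T₉ E' Es' Ns' K') ∧
        β = γ' ≫ υ'

/-- **`ReachDirectCINoseSigmaPG₂`** — ✓ `ReachDirectCINoseSigma₂` (…DefsE6) VERBATIM with ONE more inserted tail hypothesis `TowerPRamGamma ℙ F₃ υ' Z hZ R →` after
`TowerSecRoundSigma … R →` (D13). [OURS · named hypothesis fragment, no mathematical content of its own] -/
def ReachDirectCINoseSigmaPG₂ (k : Type) [Field k] (n : ℕ)
    (T₁ : Set (Literature.AlgebraicGeometry.Motives.projectiveSpace n k).left) (F₉ : Scheme.{0}) (β : F₉ ⟶ (Literature.AlgebraicGeometry.Motives.projectiveSpace n k).left) (T₉ E₉ : Set F₉) : Prop :=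
  letI := MvPolynomial.gradedAlgebra (σ := Fin (n + 1)) (R := k)
  E₉ = ∅ ∧
  ∃ (Z : Set (Literature.AlgebraicGeometry.Motives.projectiveSpace n k).left) (hZ : IsClosed Z),
    Z ⊆ T₁ ∧ ¬ (T₁ ⊆ Z) ∧ Z.Infinite ∧
    -- curve clause (= the n-SCOPE guard: fires only for n = 3)
    (∀ z : ↥(redSub (Literature.AlgebraicGeometry.Motives.projectiveSpace n k).left Z hZ), IsClosed ({z} : Set ↥(redSub (Literature.AlgebraicGeometry.Motives.projectiveSpace n k).left Z hZ)) →
      ringKrullDim ((redSub (Literature.AlgebraicGeometry.Motives.projectiveSpace n k).left Z hZ).presheaf.stalk z) = ((1 : ℕ) : WithBot ℕ∞)) ∧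
    -- (N1) finitely many non-regular points of the reduced nose `Z̃` (= the supply lemma's binder)
    Set.Finite {z : ↥(redSub (Literature.AlgebraicGeometry.Motives.projectiveSpace n k).left Z hZ) |
      ¬ IsRegularLocalRing ((redSub (Literature.AlgebraicGeometry.Motives.projectiveSpace n k).left Z hZ).presheaf.stalk z)} ∧
    -- the COMPLETE-INTERSECTION block (= ✓ `CIModel.ci_trace_and_flat`'s hypotheses read downstairs) + (HOST-J)
    (∃ (d₁ d₂ : ℕ) (f₁ f₂ : MvPolynomial (Fin (n + 1)) k),
      f₁.IsHomogeneous d₁ ∧ f₂.IsHomogeneous d₂ ∧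
      Z = {y : (Literature.AlgebraicGeometry.Motives.projectiveSpace n k).left | f₁ ∈ (y : ProjectiveSpectrum (MvPolynomial.homogeneousSubmodule (Fin (n + 1)) k)).asHomogeneousIdeal ∧
             f₂ ∈ (y : ProjectiveSpectrum (MvPolynomial.homogeneousSubmodule (Fin (n + 1)) k)).asHomogeneousIdeal} ∧
      IsRelPrime f₁ f₂ ∧ f₂ ≠ 0 ∧ (Ideal.span {f₁, f₂}).IsRadical ∧
      -- (HOST-J): the hypersurface `V₊(f₁)` is smooth at every point of `Z`
      (∀ y ∈ Z, ∃ i : Fin (n + 1), ¬ (MvPolynomial.pderiv i f₁ ∈ (y : ProjectiveSpectrum (MvPolynomial.homogeneousSubmodule (Fin (n + 1)) k)).asHomogeneousIdeal))) ∧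
    -- the DIRECT nose round at `Z` itself, then a B‴ tail (verbatim)
    ∃ (F₃ : Scheme.{0}) (υ' : F₃ ⟶ (Literature.AlgebraicGeometry.Motives.projectiveSpace n k).left),
      IsBlowup υ' (vanishingIdeal (⟨Z, hZ⟩ : Closeds (Literature.AlgebraicGeometry.Motives.projectiveSpace n k).left)) ∧
      ∃ (γ' : F₉ ⟶ F₃) (E' : Set F₉) (Es' Ns' : List (Set F₉)) (K' : Set F₉),
        (∀ R : (∀ G : Scheme.{0}, (G ⟶ F₃) → Set G → Set G → List (Set G) → List (Set G) → Set G → Prop),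
          R F₃ (𝟙 F₃) (closure (υ' ⁻¹' (T₁ \ Z))) (υ' ⁻¹' Z) [] [] ∅ →
          TowerPtRegB₄ F₃ R → TowerPtRamB₄ F₃ R → TowerRoundBTriplePrime (Literature.AlgebraicGeometry.Motives.projectiveSpace n k).left F₃ υ' Z hZ R →
          TowerSecRoundSigma (Literature.AlgebraicGeometry.Motives.projectiveSpace n k).left F₃ υ' Z hZ R →
          TowerPRamGamma (Literature.AlgebraicGeometry.Motives.projectiveSpace n k).left F₃ υ' Z hZ R →
          R F₉ γ' T₉ E' Es' Ns' K') ∧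
        β = γ' ≫ υ'

/-- **`NoseHypHostedNestEquinodalDirectCISigmaPGBTriplePrime₂ k n H ι`** (D13 blob, rule door «(ν4 ∨ ν3ᵈΣΓ) ∨ ν3ᶜⁱΣΓ») — ✓ `NoseHypHostedNestEquinodalDirectCISigmaBTriplePrime₂`
(…DefsE6, the D12 Σ-blob) VERBATIM except that the two Σ-doors are their ΣPG-variants `ReachDirectPlanarNoseSigmaPG₂` / `ReachDirectCINoseSigmaPG₂`.  More closure asked
of `Q`'s tails ⇒ implied by the Σ-blob (`…_of_directCISigma₂` below, pure logic); REPLACE shapes «¬(Σ-blob) ↦ ¬(this blob)» (50th) or «¬(47th blob) ↦ ¬(this blob)» (folded 49th).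
[OURS · L1 W4.5b · named hypothesis, no mathematical content of its own] -/
def NoseHypHostedNestEquinodalDirectCISigmaPGBTriplePrime₂ (k : Type) [Field k] [IsAlgClosed k] (n : ℕ) (H : AlgebraicGeometry.Scheme.{0})
    (ι : H ⟶ (Literature.AlgebraicGeometry.Motives.projectiveSpace n k).left) : Prop :=
  letI := MvPolynomial.gradedAlgebra (σ := Fin (n + 1)) (R := k)
  ∃ (E₀ : Set (Literature.AlgebraicGeometry.Motives.projectiveSpace n k).left),
    (E₀ = ∅ ∨ ∃ ℓ : MvPolynomial (Fin (n + 1)) k, ℓ.IsHomogeneous 1 ∧ ℓ ≠ 0 ∧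
      ¬ (Set.range ι ⊆ {y : (Literature.AlgebraicGeometry.Motives.projectiveSpace n k).left |
        ℓ ∈ (y : ProjectiveSpectrum (MvPolynomial.homogeneousSubmodule (Fin (n + 1)) k)).asHomogeneousIdeal}) ∧
      E₀ = {y : (Literature.AlgebraicGeometry.Motives.projectiveSpace n k).left |
        ℓ ∈ (y : ProjectiveSpectrum (MvPolynomial.homogeneousSubmodule (Fin (n + 1)) k)).asHomogeneousIdeal}) ∧
    (∃ (F' : AlgebraicGeometry.Scheme.{0}) (ρ' : F' ⟶ (Literature.AlgebraicGeometry.Motives.projectiveSpace n k).left) (T' : Set F'),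
      (∀ Q : (∀ F₁ : AlgebraicGeometry.Scheme.{0}, (F₁ ⟶ (Literature.AlgebraicGeometry.Motives.projectiveSpace n k).left) → Set F₁ → Set F₁ → Prop),
        Q (Literature.AlgebraicGeometry.Motives.projectiveSpace n k).left (𝟙 (Literature.AlgebraicGeometry.Motives.projectiveSpace n k).left) (Set.range ι) E₀ →
        (∀ (F₁ F₂ : AlgebraicGeometry.Scheme.{0}) (ρ : F₁ ⟶ (Literature.AlgebraicGeometry.Motives.projectiveSpace n k).left) (T₁ E₁ : Set F₁)
            (x : ↥((AlgebraicGeometry.Scheme.IdealSheafData.vanishingIdeal (⟨closure T₁, isClosed_closure⟩ : TopologicalSpace.Closeds F₁))).subscheme) (υ : F₂ ⟶ F₁) (hx : IsClosed ({(((AlgebraicGeometry.Scheme.IdealSheafData.vanishingIdeal (⟨closure T₁, isClosed_closure⟩ : TopologicalSpace.Closeds F₁))).subschemeι x : F₁)} : Set F₁)),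
          Q F₁ ρ T₁ E₁ → ¬ IsRegularLocalRing (((AlgebraicGeometry.Scheme.IdealSheafData.vanishingIdeal (⟨closure T₁, isClosed_closure⟩ : TopologicalSpace.Closeds F₁))).subscheme.presheaf.stalk x) →
          IsRegularLocalRing (F₁.presheaf.stalk (((AlgebraicGeometry.Scheme.IdealSheafData.vanishingIdeal (⟨closure T₁, isClosed_closure⟩ : TopologicalSpace.Closeds F₁))).subschemeι x : F₁)) →
          ((((AlgebraicGeometry.Scheme.IdealSheafData.vanishingIdeal (⟨closure T₁, isClosed_closure⟩ : TopologicalSpace.Closeds F₁))).subschemeι x : F₁) ∈ closure E₁ → ∀ e : ↥(redSub F₁ (closure E₁) isClosed_closure), (redSubι F₁ (closure E₁) isClosed_closure e : F₁) = (((AlgebraicGeometry.Scheme.IdealSheafData.vanishingIdeal (⟨closure T₁, isClosed_closure⟩ : TopologicalSpace.Closeds F₁))).subschemeι x : F₁) →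
          IsRegularLocalRing ((redSub F₁ (closure E₁) isClosed_closure).presheaf.stalk e)) → Literature.AlgebraicGeometry.Resolution.IsBlowup υ
            (AlgebraicGeometry.Scheme.IdealSheafData.vanishingIdeal (⟨{(((AlgebraicGeometry.Scheme.IdealSheafData.vanishingIdeal (⟨closure T₁, isClosed_closure⟩ : TopologicalSpace.Closeds F₁))).subschemeι x : F₁)}, hx⟩ : TopologicalSpace.Closeds F₁)) →
          Q F₂ (υ ≫ ρ) (closure (υ ⁻¹' (T₁ \ {(((AlgebraicGeometry.Scheme.IdealSheafData.vanishingIdeal (⟨closure T₁, isClosed_closure⟩ : TopologicalSpace.Closeds F₁))).subschemeι x : F₁)}))) (closure (υ ⁻¹' (E₁ \ {(((AlgebraicGeometry.Scheme.IdealSheafData.vanishingIdeal (⟨closure T₁, isClosed_closure⟩ : TopologicalSpace.Closeds F₁))).subschemeι x : F₁)})))) →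
        -- STAGE-LEVEL HOSTED ROUND at a regular curve `Z` inside the host, unobstructed IN THE HOST (in-host NEST lines and the nose curve alike)
        (∀ (F₁ F₃ : AlgebraicGeometry.Scheme.{0}) (ρ : F₁ ⟶ (Literature.AlgebraicGeometry.Motives.projectiveSpace n k).left) (T₁ E₁ : Set F₁) (Z : Set F₁) (hZ : IsClosed Z) (υ' : F₃ ⟶ F₁),
          Q F₁ ρ T₁ E₁ → Z ⊆ closure E₁ → Z ⊆ T₁ → ¬ T₁ ⊆ Z → (∀ z : ↥(redSub F₁ Z hZ), IsRegularLocalRing ((redSub F₁ Z hZ).presheaf.stalk z)) →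
          (∀ (i : redSub F₁ Z hZ ⟶ redSub F₁ (closure E₁) isClosed_closure), i ≫ redSubι F₁ (closure E₁) isClosed_closure = redSubι F₁ Z hZ →
            ∀ z : ↥(redSub F₁ Z hZ), IsRegularLocalRing ((redSub F₁ (closure E₁) isClosed_closure).presheaf.stalk (i z))) → DirStepUnobs F₁ (closure E₁) isClosed_closure Z hZ →
          (∀ z : ↥(redSub F₁ Z hZ), IsClosed ({z} : Set ↥(redSub F₁ Z hZ)) → ringKrullDim ((redSub F₁ Z hZ).presheaf.stalk z) = ((1 : ℕ) : WithBot ℕ∞)) →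
          Literature.AlgebraicGeometry.Resolution.IsBlowup υ' (AlgebraicGeometry.Scheme.IdealSheafData.vanishingIdeal (⟨Z, hZ⟩ : TopologicalSpace.Closeds F₁)) →
          Q F₃ (υ' ≫ ρ) (closure (υ' ⁻¹' (T₁ \ Z))) (closure (υ' ⁻¹' (closure E₁ \ Z)))) →
        (∀ (F₁ : AlgebraicGeometry.Scheme.{0}) (ρ : F₁ ⟶ (Literature.AlgebraicGeometry.Motives.projectiveSpace n k).left) (T₁ E₁ : Set F₁) (F₉ : AlgebraicGeometry.Scheme.{0}) (β : F₉ ⟶ F₁) (T₉ E₉ : Set F₉),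
          Q F₁ ρ T₁ E₁ → ReachHostedNoseBTriplePrime F₁ T₁ E₁ F₉ β T₉ E₉ → Q F₉ (β ≫ ρ) T₉ E₉) →
        -- INITIAL-STAGE NOSE, host named as the hyperplane `E₀ = V₊(ℓ)`: door ν4 «EQUINODAL» OR door ν3ᵈ «DIRECT PLANAR» (both inside the host) OR door ν3ᶜⁱ
        -- «ci-DIRECT» (`ReachDirectCINose₂`: host-free — `ℓ` is a dummy —, the nose round at the reduced ci curve `Z = V₊(f₁,f₂)` itself, upstairs centre = an explicit
        -- ci SMOOTHING, then a B‴ tail); unavailable when `E₀ = ∅`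
        (∀ (ℓ : MvPolynomial (Fin (n + 1)) k) (F₉ : AlgebraicGeometry.Scheme.{0}) (β : F₉ ⟶ (Literature.AlgebraicGeometry.Motives.projectiveSpace n k).left) (T₉ E₉ : Set F₉),
          Q (Literature.AlgebraicGeometry.Motives.projectiveSpace n k).left (𝟙 (Literature.AlgebraicGeometry.Motives.projectiveSpace n k).left) (Set.range ι) E₀ →
          E₀ = {y : (Literature.AlgebraicGeometry.Motives.projectiveSpace n k).left |
            ℓ ∈ (y : ProjectiveSpectrum (MvPolynomial.homogeneousSubmodule (Fin (n + 1)) k)).asHomogeneousIdeal} →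
          ((ReachEquinodalPlanarNose₂ k n ℓ (Set.range ι) F₉ β T₉ E₉ ∨ ReachDirectPlanarNoseSigmaPG₂ k n ℓ (Set.range ι) F₉ β T₉ E₉) ∨
              ReachDirectCINoseSigmaPG₂ k n (Set.range ι) F₉ β T₉ E₉) →
            Q F₉ β T₉ E₉) → ∃ E' : Set F', Q F' ρ' T' E') ∧
      Literature.AlgebraicGeometry.Resolution.Scheme.IsRegular (AlgebraicGeometry.Scheme.IdealSheafData.vanishingIdeal (⟨closure T', isClosed_closure⟩ : TopologicalSpace.Closeds F')).subscheme)

/-- Σ-door ν3ᵈΣ ⇒ ΣPG-door (the tail motive is asked to be closed under MORE rules). [OURS · pure logic] -/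
theorem reachDirectPlanarNoseSigmaPG₂_of_sigma₂ (k : Type) [Field k] (n : ℕ) (ℓ : MvPolynomial (Fin (n + 1)) k)
    (T₁ : Set (Literature.AlgebraicGeometry.Motives.projectiveSpace n k).left) (F₉ : Scheme.{0}) (β : F₉ ⟶ (Literature.AlgebraicGeometry.Motives.projectiveSpace n k).left) (T₉ E₉ : Set F₉)
    (h : ReachDirectPlanarNoseSigma₂ k n ℓ T₁ F₉ β T₉ E₉) : ReachDirectPlanarNoseSigmaPG₂ k n ℓ T₁ F₉ β T₉ E₉ := by
  obtain ⟨hE, Z, hZ, h1, h2, h3, h4, h5, h6, h7, h8, h9, h10, h11, F₃, υ', hb, γ', E', Es', Ns', K', hR, hβ⟩ := h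
  exact ⟨hE, Z, hZ, h1, h2, h3, h4, h5, h6, h7, h8, h9, h10, h11, F₃, υ', hb, γ', E', Es', Ns', K',
    fun R h0 hreg hram hround hsec _ => hR R h0 hreg hram hround hsec, hβ⟩

/-- Σ-door ν3ᶜⁱΣ ⇒ ΣPG-door. [OURS · pure logic] -/
theorem reachDirectCINoseSigmaPG₂_of_sigma₂ (k : Type) [Field k] (n : ℕ)
    (T₁ : Set (Literature.AlgebraicGeometry.Motives.projectiveSpace n k).left) (F₉ : Scheme.{0}) (β : F₉ ⟶ (Literature.AlgebraicGeometry.Motives.projectiveSpace n k).left) (T₉ E₉ : Set F₉)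
    (h : ReachDirectCINoseSigma₂ k n T₁ F₉ β T₉ E₉) : ReachDirectCINoseSigmaPG₂ k n T₁ F₉ β T₉ E₉ := by
  obtain ⟨hE, Z, hZ, h1, h2, h3, h4, h5, h6, F₃, υ', hb, γ', E', Es', Ns', K', hR, hβ⟩ := h
  exact ⟨hE, Z, hZ, h1, h2, h3, h4, h5, h6, F₃, υ', hb, γ', E', Es', Ns', K',
    fun R h0 hreg hram hround hsec _ => hR R h0 hreg hram hround hsec, hβ⟩

/-- the Σ-blob (D12, ✓ DefsE6) ⇒ the ΣPG-blob. [OURS · pure logic] -/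
theorem noseHypHostedNestEquinodalDirectCISigmaPGBTriplePrime₂_of_directCISigma₂ (k : Type) [Field k] [IsAlgClosed k] (n : ℕ)
    (H : AlgebraicGeometry.Scheme.{0}) (ι : H ⟶ (Literature.AlgebraicGeometry.Motives.projectiveSpace n k).left)
    (h : NoseHypHostedNestEquinodalDirectCISigmaBTriplePrime₂ k n H ι) : NoseHypHostedNestEquinodalDirectCISigmaPGBTriplePrime₂ k n H ι := by
  obtain ⟨E₀, hE₀, F', ρ', T', hQ, hreg⟩ := h
  refine ⟨E₀, hE₀, F', ρ', T', fun Q hQ0 hpt hround hreach hci => hQ Q hQ0 hpt hround hreach ?_, hreg⟩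
  intro ℓ F₉ β T₉ E₉ hQ₀ hE hR
  refine hci ℓ F₉ β T₉ E₉ hQ₀ hE ?_
  rcases hR with (hR | hR) | hR
  · exact Or.inl (Or.inl hR)
  · exact Or.inl (Or.inr (reachDirectPlanarNoseSigmaPG₂_of_sigma₂ k n ℓ _ F₉ β T₉ E₉ hR))
  · exact Or.inr (reachDirectCINoseSigmaPG₂_of_sigma₂ k n _ F₉ β T₉ E₉ hR)

/-- the 47th's blob ⇒ the ΣPG-blob. [OURS · pure logic] -/
theorem noseHypHostedNestEquinodalDirectCISigmaPGBTriplePrime₂_of_directCI₂ (k : Type) [Field k] [IsAlgClosed k] (n : ℕ)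
    (H : AlgebraicGeometry.Scheme.{0}) (ι : H ⟶ (Literature.AlgebraicGeometry.Motives.projectiveSpace n k).left)
    (h : NoseHypHostedNestEquinodalDirectCIBTriplePrime₂ k n H ι) : NoseHypHostedNestEquinodalDirectCISigmaPGBTriplePrime₂ k n H ι :=
  noseHypHostedNestEquinodalDirectCISigmaPGBTriplePrime₂_of_directCISigma₂ k n H ι
    (noseHypHostedNestEquinodalDirectCISigmaBTriplePrime₂_of_directCI₂ k n H ι h)

/-- Contrapositive, as a D13 REPLACE cut «¬(Σ-blob) ↦ ¬(ΣPG-blob)» would consume it. [OURS · pure logic] -/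
theorem not_noseHypHostedNestEquinodalDirectCISigmaBTriplePrime₂_of_not_directCISigmaPG₂ (k : Type) [Field k] [IsAlgClosed k] (n : ℕ)
    (H : AlgebraicGeometry.Scheme.{0}) (ι : H ⟶ (Literature.AlgebraicGeometry.Motives.projectiveSpace n k).left)
    (h : ¬ NoseHypHostedNestEquinodalDirectCISigmaPGBTriplePrime₂ k n H ι) : ¬ NoseHypHostedNestEquinodalDirectCISigmaBTriplePrime₂ k n H ι :=
  fun h' => h (noseHypHostedNestEquinodalDirectCISigmaPGBTriplePrime₂_of_directCISigma₂ k n H ι h')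

/-- … «¬(ΣPG-blob) → ¬(47th blob)» (the folded 49th's REPLACE shape, desk R76 (iv)). [OURS · pure logic] -/
theorem not_noseHypHostedNestEquinodalDirectCIBTriplePrime₂_of_not_directCISigmaPG₂ (k : Type) [Field k] [IsAlgClosed k] (n : ℕ)
    (H : AlgebraicGeometry.Scheme.{0}) (ι : H ⟶ (Literature.AlgebraicGeometry.Motives.projectiveSpace n k).left)
    (h : ¬ NoseHypHostedNestEquinodalDirectCISigmaPGBTriplePrime₂ k n H ι) : ¬ NoseHypHostedNestEquinodalDirectCIBTriplePrime₂ k n H ι :=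
  not_noseHypHostedNestEquinodalDirectCIBTriplePrime₂_of_not_directCISigma₂ k n H ι
    (not_noseHypHostedNestEquinodalDirectCISigmaBTriplePrime₂_of_not_directCISigmaPG₂ k n H ι h)

/-- … `¬ (ΣPG-blob) → ¬ (46th blob)`. [OURS · pure logic] -/
theorem not_noseHypHostedNestEquinodalDirectBTriplePrime₂_of_not_directCISigmaPG₂ (k : Type) [Field k] [IsAlgClosed k] (n : ℕ)
    (H : AlgebraicGeometry.Scheme.{0}) (ι : H ⟶ (Literature.AlgebraicGeometry.Motives.projectiveSpace n k).left)
    (h : ¬ NoseHypHostedNestEquinodalDirectCISigmaPGBTriplePrime₂ k n H ι) : ¬ NoseHypHostedNestEquinodalDirectBTriplePrime₂ k n H ι :=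
  not_noseHypHostedNestEquinodalDirectBTriplePrime₂_of_not_directCISigma₂ k n H ι
    (not_noseHypHostedNestEquinodalDirectCISigmaBTriplePrime₂_of_not_directCISigmaPG₂ k n H ι h)

/-- … `¬ (ΣPG-blob) → ¬ blob₃ᵉ v2`. [OURS · pure logic] -/
theorem not_noseHypHostedNestEquinodalBTriplePrime₂_of_not_directCISigmaPG₂ (k : Type) [Field k] [IsAlgClosed k] (n : ℕ)
    (H : AlgebraicGeometry.Scheme.{0}) (ι : H ⟶ (Literature.AlgebraicGeometry.Motives.projectiveSpace n k).left)
    (h : ¬ NoseHypHostedNestEquinodalDirectCISigmaPGBTriplePrime₂ k n H ι) : ¬ NoseHypHostedNestEquinodalBTriplePrime₂ k n H ι :=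
  not_noseHypHostedNestEquinodalBTriplePrime₂_of_not_directCISigma₂ k n H ι
    (not_noseHypHostedNestEquinodalDirectCISigmaBTriplePrime₂_of_not_directCISigmaPG₂ k n H ι h)

/-- … `¬ (ΣPG-blob) → ¬ blob₂`. [OURS · pure logic] -/
theorem not_noseHypHostedNestBTriplePrime₂_of_not_directCISigmaPG₂ (k : Type) [Field k] [IsAlgClosed k] (n : ℕ)
    (H : AlgebraicGeometry.Scheme.{0}) (ι : H ⟶ (Literature.AlgebraicGeometry.Motives.projectiveSpace n k).left)
    (h : ¬ NoseHypHostedNestEquinodalDirectCISigmaPGBTriplePrime₂ k n H ι) : ¬ NoseHypHostedNestBTriplePrime₂ k n H ι :=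
  not_noseHypHostedNestBTriplePrime₂_of_not_directCISigma₂ k n H ι
    (not_noseHypHostedNestEquinodalDirectCISigmaBTriplePrime₂_of_not_directCISigmaPG₂ k n H ι h)

/-- … `¬ (ΣPG-blob) → ¬ NoseHypPointsFirstBTriplePrime`. [OURS · pure logic] -/
theorem not_noseHypPointsFirstBTriplePrime_of_not_directCISigmaPG₂ (k : Type) [Field k] [IsAlgClosed k] (n : ℕ)
    (H : AlgebraicGeometry.Scheme.{0}) (ι : H ⟶ (Literature.AlgebraicGeometry.Motives.projectiveSpace n k).left)
    (h : ¬ NoseHypHostedNestEquinodalDirectCISigmaPGBTriplePrime₂ k n H ι) : ¬ NoseHypPointsFirstBTriplePrime k n H ι :=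
  not_noseHypPointsFirstBTriplePrime_of_not_directCISigma₂ k n H ι
    (not_noseHypHostedNestEquinodalDirectCISigmaBTriplePrime₂_of_not_directCISigmaPG₂ k n H ι h)

end Summit.ResolutionOfSingularities.ResolutionOfSingularities.Cruxes.EquisingularLiftNat.Sections

end
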